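import Summits.BirchSwinnertonDyer.Rank1Residual.AdditivePotMult.TwistSupplyRamified
import Summits.BirchSwinnertonDyer.Rank1Residual.EisensteinPrimes
import Literature.NumberTheory.EllipticCurves.PAdicHeightsTateValuationProofs
import HarnessLib

/-!
# X4(M): the `j`-WITNESS — a rank-zero (ram) `p`-multiplicative twist exists for EVERY pair with a
# prime `q ≠ p`, `ord_q j(E) < 0`, `p ∤ ord_q j(E)`; and NO twist satisfies (ram) otherwise

HONEST FRAMING (cell `b2b-bsdres`, run/shared/lean/b2b/bsd-rank1-residual/, verbatim in every
file): the goal of the cell is to DELETE the COMBINATION-SHAPED residual classes of the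
Birch–Swinnerton-Dyer formula for ALL analytic-rank `≤ 1` elliptic curves over `ℚ` — "full BSD
formula for every rank `≤ 1` curve in class `C`" assembled STRICTLY from published theorems — so
that the rank-`≤ 1` remainder becomes exactly the CONSTRUCTION-SHAPED classes, which are TYPED
(missing-input `Prop`s), NOT attempted. This is not "finishing BSD". Sub-cell
`b2b-bsdres-additive-p1` (CLASS-OWNERS row "X3/X4 additive — pot. multiplicative / X3♯(M)"),
generation 4; research route, no claim beyond the stated sub-classes; X4(M) REMAINS
CONSTRUCTION-SHAPED.

Theorems only; no definition, no new named fact. Generation 3 (`TwistSupplyRam.lean`,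
`TwistSupplyX4.lean`) proved: for `(E,p) ∈ X4(M)` of analytic rank `≤ 1`, `BSD(E,p)` follows from
the typed over-`K` input `MissingPPartOverCAt (W.baseChange K) p` over quadratic fields ALONE as
soon as `E` ITSELF has a multiplicative prime `q ≠ p` with `p ∤ ord_q Δ_min(E)` (`Ram W p`; census
1673 ‖ 398 of the 1754 ‖ 418 pairs), the (ram)-witness being transported to the rank-zero
`p`-multiplicative twist by a `q`-adic adjustment of the twisting parameter. Census remainder:
10 ‖ 0 pairs whose only (ram)-capable primes `q` (`ord_q j < 0`, `p ∤ ord_q j`) are ADDITIVE for `E`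
("a two-prime square-class approximation, not formalised") and 71 ‖ 20 pairs with no such `q`. This
file does the two-prime approximation and proves that the complement is structural:

* §1 `padicValRat_j_eq_neg_of_mult` — **`ord_q j(E) = −ord_q Δ_min(E)` at a multiplicative prime**
  (Silverman *AEC* VII.5.1(b)) on a globally minimal model, in the `padicVal` currency of the cell's
  predicate `Ram` (Mathlib's `HasMultiplicativeReduction` has unit `c₄`; two `ℤ_q`-minimal
  equations have the same `ord_q Δ`, tree `padicValuation_Δ_minimal_eq`).
* §2 `exists_twist_mult_of_padicValRat_j_neg` — `ord_q j(E) < 0` ⇒ some `E^{(d)}` is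
  multiplicative at `q` (Silverman *ATAEC* V.5.3; gen 0's `PotMult.exists_twist_mult` without the
  additivity clause).
* §3 `exists_jWitness_of_ram`, `not_ram_model_twist_of_forall_dvd` — a (ram)-witness of `E` is a
  `j`-WITNESS (`q ≠ p` prime, `ord_q j(E) < 0`, `p ∤ ord_q j(E)`); and if `E` has NO `j`-witness
  then NO globally minimal model of ANY quadratic twist of `E` satisfies (ram) at `p` (`j` is a
  twist invariant and §1) — the no-go half of the dichotomy.
* §4 `isSquare_padic_mul_of_pow_dvd_sub`, `exists_int_isSquare_padic_pair`,
  `exists_mul_eq_mul_isSquare_padic` — the **two-prime square-class approximation**: for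
  `a, b ∈ ℚ^×` and primes `p ≠ q` there are `x ∈ ℚ^× ∩ ℚ_p^{×2}`, `y ∈ ℚ^× ∩ ℚ_q^{×2}` with
  `a x = b y` (CRT for the moduli `p^{ord_p+3}`, `q^{ord_q+3}`, Hensel resp. mod `8`; Serre, *Cours
  d'arithmétique* II.3.3; weak approximation for square classes at two places).
* §5 `exists_twist_mult_mult` — a quadratic twist multiplicative at BOTH `p` and `q` when
  `ord_p j, ord_q j < 0`; **`ClassX4M.exists_ram_rankZero_mult_twist_of_jWitness`** — for
  `(E,p) ∈ X4(M)` with a `j`-witness `q` there are a quadratic field `K` and a globally minimal model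
  `Wd` of `E^{(d_K)}` with `Mult Wd p`, `Irr Wd p`, `Ram Wd p`, `r_an(Wd) = 0` (gen 3's twist supply
  `exists_rankZero_mult_twist_of_mult_twist` split at `q`; binders: modularity `hnf`, Hoffstein–Luo
  1997 `hHL`).

The class theorems built on §5 (over-`K` input ALONE on X4(M) ∧ (`j`-witness): 1683 ‖ 398 pairs =
gen 3's 1673 ‖ 398 plus the 10 ‖ 0) and the dichotomy are in `TwistSupplyJClass.lean`. Census:
`HOME/b2b-bsdres-additive-p1/census-g3/` (REPORT §7.2). Nothing is booked; no label moves.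
-/

noncomputable section

open scoped Classical NumberField

open WeierstrassCurve Literature.NumberTheory.EllipticCurves
  Literature.NumberTheory.EllipticCurves.ModularForms
  Literature.NumberTheory.EllipticCurves.Rank1Residual
  Literature.NumberTheory.EllipticCurves.Rank1Residual.Typed
  IsDedekindDomain

namespace Summit.BirchSwinnertonDyer.Rank1Residual.AdditivePotMult

/-! ### §1 `ord_q j(E) = -ord_q Δ_min(E)` at a multiplicative prime `q` -/

/-- **`ord_q j(E) = −ord_q Δ_min(E)` at a prime `q` of multiplicative reduction** (Silverman *AEC*
VII.5 Prop. 5.1(b): a minimal equation with multiplicative reduction has `v(c₄) = 0`, and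
`j Δ = c₄³`). On a globally minimal `ℚ`-model `V`: the model is `ℤ_q`-minimal
(`isMinimal_baseChange_padic_of_isGloballyMinimal`, *AEC* VIII.8), Mathlib's chosen `ℤ_q`-minimal
equation has unit `c₄` (definition of `HasMultiplicativeReduction`) and the same `ord_q Δ`
(`padicValuation_Δ_minimal_eq`, *AEC* VII.1.3(b)), and `Δ(V) = Δ_min(V)`
(`padicValuation_Δ_baseChange_eq_padicValInt`). [cite: SilvermanAEC2009, VII.5 Prop. 5.1(b)] -/
theorem padicValRat_j_eq_neg_of_mult (V : WeierstrassCurve ℚ) [V.IsElliptic] [V.IsGloballyMinimal]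
    (q : ℕ) [hq : Fact q.Prime] (hmult : Mult V q) :
    padicValRat q V.j = -(padicValInt q V.minimalDiscriminantInt : ℤ) := by
  -- the globally minimal equation is `ℤ_q`-minimal
  haveI hXmin : (V.baseChange ℚ_[q]).IsMinimal ℤ_[q] := by
    obtain ⟨v, hv⟩ := (Rat.HeightOneSpectrum.primesEquiv (R := 𝓞 ℚ)).surjective ⟨q, hq.out⟩
    have hvq : ((Rat.HeightOneSpectrum.primesEquiv v : Nat.Primes) : ℕ) = q :=
      congrArg Subtype.val hv
    subst hvq
    exact isMinimal_baseChange_padic_of_isGloballyMinimal V v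
  set X : WeierstrassCurve ℚ_[q] := V.baseChange ℚ_[q] with hX
  haveI hXell : X.IsElliptic := inferInstanceAs (V.map (algebraMap ℚ ℚ_[q])).IsElliptic
  set Wm : WeierstrassCurve ℚ_[q] := X.minimal ℤ_[q] with hWm
  haveI hWell : Wm.IsElliptic := by
    rw [hWm, WeierstrassCurve.minimal]; infer_instance
  have hmul : Wm.HasMultiplicativeReduction ℤ_[q] := hmult
  -- `c₄(Wm)` is a `q`-adic unit
  obtain ⟨rc, hrc⟩ : ∃ r : ℤ_[q], (r : ℚ_[q]) = Wm.c₄ := ⟨_, integralModel_c₄_eq ℤ_[q] Wm⟩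
  have hc₄ := hmul.multiplicativeReduction
  rw [← hrc, ← PadicInt.algebraMap_apply, HeightOneSpectrum.valuation_eq_one_iff_notMem] at hc₄
  change rc ∉ IsLocalRing.maximalIdeal ℤ_[q] at hc₄
  rw [IsLocalRing.mem_maximalIdeal, PadicInt.mem_nonunits] at hc₄
  have hrc1 : ‖rc‖ = 1 := le_antisymm (PadicInt.norm_le_one _) (not_lt.mp hc₄)
  have hrc0 : rc ≠ 0 := by
    intro h; rw [h, norm_zero] at hrc1; exact zero_ne_one hrc1
  have hc0 : (rc : ℚ_[q]) ≠ 0 := PadicInt.coe_ne_zero.mpr hrc0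
  have hq1 : (1 : ℝ) < q := by exact_mod_cast hq.out.one_lt
  have hvc : Padic.valuation Wm.c₄ = 0 := by
    rw [← hrc]
    have h := Padic.norm_eq_zpow_neg_valuation hc0
    rw [← PadicInt.norm_def, hrc1] at h
    have h' : (q : ℝ) ^ (-(rc : ℚ_[q]).valuation) = (q : ℝ) ^ (0 : ℤ) := by rw [zpow_zero, ← h]
    have := (zpow_right_strictMono₀ hq1).injective h'
    omega
  -- `j(V) · Δ(Wm) = c₄(Wm)³`
  have hjX : X.j = ((V.j : ℚ) : ℚ_[q]) := by
    simp only [hX, baseChange, map_j, eq_ratCast]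
  have hjm : Wm.j = ((V.j : ℚ) : ℚ_[q]) := by
    show ((X.exists_isMinimal ℤ_[q]).choose • X).j = _
    rw [variableChange_j, hjX]
  have key : ((V.j : ℚ) : ℚ_[q]) * Wm.Δ = Wm.c₄ ^ 3 := by
    rw [← hjm, WeierstrassCurve.j, ← WeierstrassCurve.coe_Δ', mul_comm, ← mul_assoc,
      Units.mul_inv, one_mul]
  have hc40 : Wm.c₄ ≠ 0 := by rw [← hrc]; exact hc0
  have hXΔ : X.Δ ≠ 0 := X.isUnit_Δ.ne_zero
  have hΔm0 : Wm.Δ ≠ 0 := by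
    rw [hWm, WeierstrassCurve.minimal, variableChange_Δ]
    exact mul_ne_zero (pow_ne_zero _ (Units.ne_zero _)) hXΔ
  have hj0 : ((V.j : ℚ) : ℚ_[q]) ≠ 0 := by
    intro h
    rw [h, zero_mul] at key
    exact pow_ne_zero 3 hc40 key.symm
  -- valuations
  have hval := congrArg Padic.valuation key
  rw [Padic.valuation_mul hj0 hΔm0, Padic.valuation_pow, hvc, mul_zero, Padic.valuation_ratCast,
    hWm, padicValuation_Δ_minimal_eq X hXΔ, hX, padicValuation_Δ_baseChange_eq_padicValInt] at hval
  omega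

/-- At a multiplicative prime `q` of a globally minimal `V`: `p ∣ ord_q Δ_min(V)` iff
`p ∣ ord_q j(V)`. [folklore] -/
theorem dvd_padicValInt_minimalDiscriminantInt_iff_of_mult (V : WeierstrassCurve ℚ) [V.IsElliptic]
    [V.IsGloballyMinimal] (q : ℕ) [Fact q.Prime] (hmult : Mult V q) (p : ℕ) :
    p ∣ padicValInt q V.minimalDiscriminantInt ↔ (p : ℤ) ∣ padicValRat q V.j := by
  rw [padicValRat_j_eq_neg_of_mult V q hmult, dvd_neg, Int.natCast_dvd_natCast]

/-! ### §2 A curve with `ord_q j < 0` has a `q`-multiplicative quadratic twist -/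

variable {W : WeierstrassCurve ℚ} [W.IsElliptic] {p : ℕ} [Fact p.Prime]

/-- **`ord_q j(E) < 0` ⇒ some quadratic twist `E^{(d)}` is multiplicative at `q`** (Silverman
*ATAEC* V.5.3, *AEC* VII.5.5; the tree's
`exists_hasMultiplicativeReductionAt_quadraticTwist_of_one_lt_valuation_j`). This is
`PotMult.exists_twist_mult` without the additivity clause: `E` may itself be multiplicative at `q`
or additive potentially multiplicative there. [folklore] -/
theorem exists_twist_mult_of_padicValRat_j_neg {q : ℕ} [hq : Fact q.Prime]
    (h : padicValRat q W.j < 0) : ∃ d : ℚ, d ≠ 0 ∧ Mult (W.quadraticTwist d) q := by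
  set P : Nat.Primes := ⟨q, hq.out⟩ with hP
  set v : HeightOneSpectrum ℤ := (Rat.HeightOneSpectrum.primesEquiv (R := ℤ)).symm P with hv_def
  have hv : Rat.HeightOneSpectrum.natGenerator v = q :=
    congrArg Subtype.val ((Rat.HeightOneSpectrum.primesEquiv (R := ℤ)).apply_symm_apply P)
  have hj0 : W.j ≠ 0 := by
    intro h0
    rw [h0, padicValRat.zero] at h
    exact lt_irrefl _ h
  have hval : 1 < v.valuation ℚ W.j := by
    rw [Rat.HeightOneSpectrum.valuation_eq_exp_neg_padicValRat v hj0, hv, ← WithZero.exp_zero,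
      WithZero.exp_lt_exp]
    linarith
  obtain ⟨d, hd0, hmult⟩ :=
    W.exists_hasMultiplicativeReductionAt_quadraticTwist_of_one_lt_valuation_j v hval
  refine ⟨d, hd0, ?_⟩
  haveI := W.isElliptic_quadraticTwist hd0
  exact ((W.quadraticTwist d).hasMultiplicativeReductionAtPrime_iff_hasMultiplicativeReductionAt_holds
    P).mpr hmult

/-! ### §3 The no-go half of the dichotomy: without a `j`-witness every twist fails (ram) -/

/-- The `j`-invariant of a `ℚ`-model of a quadratic twist is `j(E)`. [folklore] -/
theorem j_of_model_twist {d : ℚ} (hd : d ≠ 0) {Wd : WeierstrassCurve ℚ} [Wd.IsElliptic]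
    (hWd : ∃ C : VariableChange ℚ, C • W.quadraticTwist d = Wd) : Wd.j = W.j := by
  obtain ⟨C, rfl⟩ := hWd
  haveI := W.isElliptic_quadraticTwist hd
  rw [variableChange_j, W.j_quadraticTwist hd]

/-- **(ram) on E itself gives a `j`-witness**: if a globally minimal `W` has a multiplicative prime
`q ≠ p` with `p ∤ ord_q Δ_min` (`Ram W p`), then `ord_q j(W) < 0` and `p ∤ ord_q j(W)`. So the
`j`-criterion of this file contains gen 3's hypothesis `Ram W p` (`bsdp_of_classX4M_of_ram`).
[folklore] -/
theorem exists_jWitness_of_ram [W.IsGloballyMinimal] (hram : Ram W p) :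
    ∃ q : ℕ, q.Prime ∧ q ≠ p ∧ padicValRat q W.j < 0 ∧ ¬ (p : ℤ) ∣ padicValRat q W.j := by
  obtain ⟨q, iq, hqp, hmult, hv⟩ := hram
  refine ⟨q, iq.out, hqp, EisensteinPrimes.padicValRat_j_neg_of_mult W q hmult, ?_⟩
  rwa [← dvd_padicValInt_minimalDiscriminantInt_iff_of_mult W q hmult p]

/-- **No `j`-witness ⇒ no twist of `E` satisfies (ram) at `p`.** If every prime `q ≠ p` with
`ord_q j(E) < 0` has `p ∣ ord_q j(E)`, then for every `d ∈ ℚ^×` and every globally minimal model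
`Wd` of `E^{(d)}`, `¬ Ram Wd p`: a (ram)-witness `ℓ` of `Wd` is multiplicative for `Wd`, so
`ord_ℓ Δ_min(Wd) = −ord_ℓ j(Wd) = −ord_ℓ j(E)` (`padicValRat_j_eq_neg_of_mult`; `j` is a twist
invariant), and `p ∣ ord_ℓ j(E)`. In particular the 71 ‖ 20 census pairs of X4(M) with no such `q`
(REPORT §6.5/§7.2) are STRUCTURALLY outside the reach of Skinner 2016 Thm. C on any twist: every
`p`-multiplicative twist of theirs is an X11a-type pair (`¬ram`). [folklore] -/
theorem not_ram_model_twist_of_forall_dvd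
    (hall : ∀ q : ℕ, q.Prime → q ≠ p → padicValRat q W.j < 0 → (p : ℤ) ∣ padicValRat q W.j)
    {d : ℚ} (hd : d ≠ 0) (Wd : WeierstrassCurve ℚ) [Wd.IsElliptic] [Wd.IsGloballyMinimal]
    (hWd : ∃ C : VariableChange ℚ, C • W.quadraticTwist d = Wd) : ¬ Ram Wd p := by
  rintro ⟨ℓ, iℓ, hℓp, hmult, hv⟩
  have hj : Wd.j = W.j := j_of_model_twist hd hWd
  have hneg : padicValRat ℓ W.j < 0 := by
    rw [← hj]; exact EisensteinPrimes.padicValRat_j_neg_of_mult Wd ℓ hmult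
  have hdvd := hall ℓ iℓ.out hℓp hneg
  rw [← hj, ← dvd_padicValInt_minimalDiscriminantInt_iff_of_mult Wd ℓ hmult p] at hdvd
  exact hv hdvd

/-- The same for `E` itself (`d = 1`): no `j`-witness ⇒ `¬ Ram W p`. [folklore] -/
theorem not_ram_of_forall_dvd [W.IsGloballyMinimal]
    (hall : ∀ q : ℕ, q.Prime → q ≠ p → padicValRat q W.j < 0 → (p : ℤ) ∣ padicValRat q W.j) :
    ¬ Ram W p := by
  intro hram
  obtain ⟨q, hq, hqp, hneg, hndvd⟩ := exists_jWitness_of_ram (W := W) (p := p) hram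
  exact hndvd (hall q hq hqp hneg)

/-! ### §4 Two-prime square-class approximation for a twisting parameter -/

/-- **`B t` is a `p`-adic square when `p^{ord_p B + 3} ∣ t − B`.** For a nonzero integer `B` and an
integer `t`: writing `B = p^v B'` with `p ∤ B'` and `t = B + p^{v+3} s`,
`B t = (p^v)² (B'² + p³ B' s)`, and `B'² + p³ B' s` is `≡ B'²`, a nonzero square mod `p` (`p` odd),
resp. `≡ B'² ≡ 1 (mod 8)` (`p = 2`), hence a `p`-adic square (Hensel; Serre, *Cours
d'arithmétique* II.3.3; tree `padic_isSquare_intCast_of_isSquare_zmod`,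
`padic_isSquare_intCast_of_mod_eight`). [folklore] -/
theorem isSquare_padic_mul_of_pow_dvd_sub {p : ℕ} [hp : Fact p.Prime] {B t : ℤ} (hB : B ≠ 0)
    (ht : (p : ℤ) ^ (padicValInt p B + 3) ∣ t - B) :
    IsSquare ((B * t : ℤ) : ℚ_[p]) := by
  have hpP : p.Prime := hp.out
  have hpZ : Prime (p : ℤ) := Nat.prime_iff_prime_int.mp hpP
  set v : ℕ := padicValInt p B with hv
  obtain ⟨B', hB'⟩ := padicValInt_dvd (p := p) B
  have hpB' : ¬ (p : ℤ) ∣ B' := by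
    intro h
    have h1 : (p : ℤ) ^ (v + 1) ∣ B := by
      rw [hB', pow_succ]; exact mul_dvd_mul_left _ h
    rcases (padicValInt_dvd_iff (v + 1) B).mp h1 with h0 | hle
    · exact hB h0
    · omega
  obtain ⟨s, hs⟩ := ht
  have ht' : t = B + (p : ℤ) ^ (v + 3) * s := by rw [← hs]; ring
  set m : ℤ := B' * B' + (p : ℤ) ^ 3 * (B' * s) with hm
  have hBt : B * t = ((p : ℤ) ^ v) ^ 2 * m := by
    rw [ht', hB', hm]; ring
  have hmsq : IsSquare ((m : ℤ) : ℚ_[p]) := by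
    by_cases hp2 : p = 2
    · apply Literature.NumberTheory.QuadraticForms.padic_isSquare_intCast_of_mod_eight hp2
      have hodd : ¬ (2 : ℤ) ∣ B' := by rw [hp2] at hpB'; exact_mod_cast hpB'
      have h8 : (p : ℤ) ^ 3 = 8 := by rw [hp2]; norm_num
      have hm' : m = B' * B' + 8 * (B' * s) := by rw [hm, h8]
      have hB'8 : B' % 8 = 1 ∨ B' % 8 = 3 ∨ B' % 8 = 5 ∨ B' % 8 = 7 := by omega
      rw [hm', Int.add_mul_emod_self_left, Int.mul_emod]
      rcases hB'8 with h | h | h | h <;> rw [h] <;> norm_num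
    · have hpm : ¬ (p : ℤ) ∣ m := by
        intro h
        have h3 : (p : ℤ) ∣ (p : ℤ) ^ 3 * (B' * s) :=
          dvd_mul_of_dvd_left (dvd_pow_self _ three_ne_zero) _
        have h2 : (p : ℤ) ∣ B' * B' := by
          have := dvd_sub h h3
          rwa [hm, add_sub_cancel_right] at this
        rcases hpZ.dvd_or_dvd h2 with h4 | h4 <;> exact hpB' h4
      have hzm : IsSquare ((m : ℤ) : ZMod p) := by
        refine ⟨(B' : ZMod p), ?_⟩
        have hp0 : ((p : ℕ) : ZMod p) = 0 := ZMod.natCast_self p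
        rw [hm]; push_cast; rw [hp0]; ring
      exact Literature.NumberTheory.QuadraticForms.padic_isSquare_intCast_of_isSquare_zmod hp2 hpm hzm
  have hcast : ((B * t : ℤ) : ℚ_[p]) = (((p : ℤ) ^ v : ℤ) : ℚ_[p]) ^ 2 * ((m : ℤ) : ℚ_[p]) := by
    rw [hBt]; push_cast; ring
  rw [hcast]
  exact (IsSquare.sq _).mul hmsq

/-- **Two-prime square-class approximation** (weak approximation for
`ℚ^× → ℚ_p^×/ℚ_p^{×2} × ℚ_q^×/ℚ_q^{×2}`, in the integral form needed here). For nonzero integers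
`A`, `B` and distinct primes `p`, `q` there is an integer `t ≠ 0` with `B t` a square in `ℚ_p` and
`A t` a square in `ℚ_q`: Chinese remainder theorem for the moduli `p^{ord_p B + 3}`,
`q^{ord_q A + 3}` (`Nat.chineseRemainder`) and `isSquare_padic_mul_of_pow_dvd_sub`. [folklore] -/
theorem exists_int_isSquare_padic_pair {p q : ℕ} [hp : Fact p.Prime] [hq : Fact q.Prime]
    (hpq : p ≠ q) {A B : ℤ} (hA : A ≠ 0) (hB : B ≠ 0) :
    ∃ t : ℤ, t ≠ 0 ∧ IsSquare ((B * t : ℤ) : ℚ_[p]) ∧ IsSquare ((A * t : ℤ) : ℚ_[q]) := by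
  set mP : ℕ := p ^ (padicValInt p B + 3) with hmP
  set mQ : ℕ := q ^ (padicValInt q A + 3) with hmQ
  have hco : Nat.Coprime mP mQ :=
    Nat.Coprime.pow _ _ ((Nat.coprime_primes hp.out hq.out).mpr hpq)
  have hmP0 : (0 : ℤ) < mP := by exact_mod_cast pow_pos hp.out.pos _
  have hmQ0 : (0 : ℤ) < mQ := by exact_mod_cast pow_pos hq.out.pos _
  obtain ⟨k, hkP, hkQ⟩ := Nat.chineseRemainder hco (Int.toNat (B % mP)) (Int.toNat (A % mQ))
  -- the congruences of `t = k + mP mQ`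
  have hdvd : ∀ {m n : ℕ} {C : ℤ}, (0 : ℤ) < m → k ≡ Int.toNat (C % m) [MOD m] →
      (m : ℤ) ∣ (k : ℤ) + m * n - C := by
    intro m n C hm0 hk
    have hk' : (k : ℤ) ≡ ((Int.toNat (C % m) : ℕ) : ℤ) [ZMOD m] := Int.natCast_modEq_iff.mpr hk
    rw [Int.toNat_of_nonneg (Int.emod_nonneg _ hm0.ne')] at hk'
    have h1 : (m : ℤ) ∣ (k : ℤ) - C % m := hk'.symm.dvd
    have h2 : (m : ℤ) ∣ C % m - C := ⟨-(C / m), by rw [Int.emod_def]; ring⟩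
    have h3 : (m : ℤ) ∣ (m : ℤ) * n := dvd_mul_right _ _
    have e : (k : ℤ) + m * n - C = ((k : ℤ) - C % m) + (C % m - C) + m * n := by ring
    rw [e]
    exact dvd_add (dvd_add h1 h2) h3
  have htpos : (0 : ℤ) < (k : ℤ) + mP * mQ :=
    add_pos_of_nonneg_of_pos (by positivity) (mul_pos hmP0 hmQ0)
  refine ⟨(k : ℤ) + mP * mQ, htpos.ne', ?_, ?_⟩
  · apply isSquare_padic_mul_of_pow_dvd_sub hB
    have h := hdvd (n := mQ) (C := B) hmP0 hkP
    simpa [hmP] using h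
  · apply isSquare_padic_mul_of_pow_dvd_sub hA
    have h := hdvd (n := mP) (C := A) hmQ0 hkQ
    have e : (k : ℤ) + mP * mQ = (k : ℤ) + mQ * mP := by ring
    rw [e]
    simpa [hmQ] using h

/-- **Rational form: a common twisting parameter.** For `a, b ∈ ℚ^×` and distinct primes `p`, `q`
there are `x, y ∈ ℚ^×` with `a x = b y`, `x` a square in `ℚ_p` and `y` a square in `ℚ_q` (apply
`exists_int_isSquare_padic_pair` to `num(a) den(a)`, `num(b) den(b)`, which have the square classes
of `a`, `b`; `x = b t`, `y = a t`). [folklore] -/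
theorem exists_mul_eq_mul_isSquare_padic {p q : ℕ} [Fact p.Prime] [Fact q.Prime] (hpq : p ≠ q)
    {a b : ℚ} (ha : a ≠ 0) (hb : b ≠ 0) :
    ∃ x y : ℚ, x ≠ 0 ∧ y ≠ 0 ∧ a * x = b * y ∧
      IsSquare (algebraMap ℚ ℚ_[p] x) ∧ IsSquare (algebraMap ℚ ℚ_[q] y) := by
  set A : ℤ := a.num * a.den with hA
  set B : ℤ := b.num * b.den with hB
  have hA0 : A ≠ 0 := mul_ne_zero (Rat.num_ne_zero.mpr ha) (by exact_mod_cast a.den_nz)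
  have hB0 : B ≠ 0 := mul_ne_zero (Rat.num_ne_zero.mpr hb) (by exact_mod_cast b.den_nz)
  obtain ⟨t, ht0, hBt, hAt⟩ := exists_int_isSquare_padic_pair hpq hA0 hB0
  have htQ : (t : ℚ) ≠ 0 := by exact_mod_cast ht0
  -- `c t = (num(c) den(c) t) / den(c)²`
  have key : ∀ c : ℚ, c * t = (((c.num * c.den * t : ℤ)) : ℚ) / ((c.den : ℚ)) ^ 2 := by
    intro c
    have hd : (c.den : ℚ) ≠ 0 := by exact_mod_cast c.den_nz
    have hc : (c : ℚ) = c.num / c.den := (Rat.num_div_den c).symm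
    conv_lhs => rw [hc]
    push_cast
    field_simp
  refine ⟨b * t, a * t, mul_ne_zero hb htQ, mul_ne_zero ha htQ, by ring, ?_, ?_⟩
  · rw [eq_ratCast, key b, Rat.cast_div, Rat.cast_pow, Rat.cast_natCast, Rat.cast_intCast]
    exact hBt.div (IsSquare.sq _)
  · rw [eq_ratCast, key a, Rat.cast_div, Rat.cast_pow, Rat.cast_natCast, Rat.cast_intCast]
    exact hAt.div (IsSquare.sq _)

/-! ### §5 A twist multiplicative at two primes; the (ram) rank-zero twist from a `j`-witness -/

/-- **A quadratic twist multiplicative at two prescribed primes.** If `ord_p j(E) < 0` and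
`ord_q j(E) < 0` for distinct primes `p`, `q`, some quadratic twist `E^{(d)}` is multiplicative at
both `p` and `q`: twists `E^{(a)}`, `E^{(b)}` multiplicative at `p`, resp. `q`
(`exists_twist_mult_of_padicValRat_j_neg`), a common parameter `d = a x = b y` with
`x ∈ ℚ_p^{×2}`, `y ∈ ℚ_q^{×2}` (`exists_mul_eq_mul_isSquare_padic`), and gen 2's
`mult_quadraticTwist_mul_of_padicSquare`. [folklore] -/
theorem exists_twist_mult_mult {q : ℕ} [Fact q.Prime] (hpq : p ≠ q)
    (hjp : padicValRat p W.j < 0) (hjq : padicValRat q W.j < 0) :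
    ∃ d : ℚ, d ≠ 0 ∧ Mult (W.quadraticTwist d) p ∧ Mult (W.quadraticTwist d) q := by
  obtain ⟨a, ha, hmp⟩ := exists_twist_mult_of_padicValRat_j_neg (W := W) hjp
  obtain ⟨b, hb, hmq⟩ := exists_twist_mult_of_padicValRat_j_neg (W := W) hjq
  obtain ⟨x, y, hx, hy, hab, hxsq, hysq⟩ := exists_mul_eq_mul_isSquare_padic hpq ha hb
  refine ⟨a * x, mul_ne_zero ha hx, mult_quadraticTwist_mul_of_padicSquare ha hx hxsq hmp, ?_⟩
  rw [hab]
  exact mult_quadraticTwist_mul_of_padicSquare hb hy hysq hmq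

/-- **X4(M) with a `j`-witness: the rank-zero (ram) `p`-multiplicative twist EXISTS.** Let
`(E,p) ∈ X4(M)` (`W` globally minimal) and let `q ≠ p` be a prime with `ord_q j(E) < 0` and
`p ∤ ord_q j(E)` (a `j`-WITNESS; `E` may be multiplicative or additive at `q`). Then there are a
quadratic field `K` and a globally minimal model `Wd` of `E^{(d_K)}` with `Mult Wd p`, `Irr Wd p`,
`Ram Wd p` (witness `q`) and `r_an(Wd) = 0` — assuming modularity (`hnf`) and Hoffstein–Luo 1997
(`hHL`). Proof: a twist `W₁` multiplicative at `p` and `q` (`exists_twist_mult_mult`), for which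
`ord_q Δ_min(W₁) = −ord_q j(E)` is prime to `p` (§1); then gen 3's
`exists_rankZero_mult_twist_of_mult_twist` split at `q`. This removes the last census artefact of
the relocation: gen 3 needed `q` MULTIPLICATIVE for `E` (`Ram W p`); the 10 ‖ 0 X4(M) census pairs
whose only such `q` are additive for `E` are now included. [folklore] -/
theorem ClassX4M.exists_ram_rankZero_mult_twist_of_jWitness [W.IsGloballyMinimal]
    (hX : ClassX4M W p) {q : ℕ} (hq : q.Prime) (hqp : q ≠ p) (hjq : padicValRat q W.j < 0)
    (hpj : ¬ (p : ℤ) ∣ padicValRat q W.j) (hnf : exists_isNewformOf)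
    (hHL : HoffsteinLuo1997_exists_twist_L_one_ne_zero) :
    ∃ (K : Type) (_ : Field K) (_ : NumberField K) (Wd : WeierstrassCurve ℚ) (_ : Wd.IsElliptic)
      (_ : Wd.IsGloballyMinimal), Module.finrank ℚ K = 2 ∧
      (∃ C : VariableChange ℚ, C • W.quadraticTwist (NumberField.discr K : ℚ) = Wd) ∧
      Mult Wd p ∧ Irr Wd p ∧ Ram Wd p ∧ Wd.analyticRank = 0 := by
  haveI : Fact q.Prime := ⟨hq⟩
  have hp2 : p ≠ 2 := hX.p_ne_two
  obtain ⟨d, hd, hmp, hmq⟩ :=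
    exists_twist_mult_mult (W := W) (p := p) (Ne.symm hqp) hX.potMult.2 hjq
  obtain ⟨W₁, iW₁, iW₁m, C₁, hC₁⟩ := exists_globallyMinimal_model_twist W hd
  have hmult₁ : Mult W₁ p := mult_of_model_twist hd hmp ⟨C₁, hC₁⟩
  have hmultq₁ : Mult W₁ q := mult_of_model_twist hd hmq ⟨C₁, hC₁⟩
  have hv₁ : ¬ p ∣ padicValInt q W₁.minimalDiscriminantInt := by
    rw [dvd_padicValInt_minimalDiscriminantInt_iff_of_mult W₁ q hmultq₁ p,
      j_of_model_twist hd ⟨C₁, hC₁⟩]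
    exact hpj
  obtain ⟨K, iF, iN, Wd, iWd, iWdm, h2, hWd, hmult, hr0, hQ⟩ :=
    exists_rankZero_mult_twist_of_mult_twist hnf hHL hp2 hX.potMult.not_mult hd W₁ ⟨C₁, hC₁⟩
      hmult₁ {q}
  obtain ⟨hmultdq, hvdq⟩ := hQ q (Finset.mem_singleton_self q) hqp
  have hD : (NumberField.discr K : ℚ) ≠ 0 := by exact_mod_cast NumberField.discr_ne_zero K
  refine ⟨K, iF, iN, Wd, iWd, iWdm, h2, hWd, hmult, (irr_iff_of_model_twist hD hWd).mpr hX.irr,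
    ⟨q, inferInstance, hqp, hmultdq hmultq₁, ?_⟩, hr0⟩
  rw [hvdq]; exact hv₁

end Summit.BirchSwinnertonDyer.Rank1Residual.AdditivePotMult

end
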